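import Summits.CriticalPhenomena.PercolationContinuityZ3.Theorems.PercNearOneGluingNoHeavyLowerTailSunflowerDeltaCore
import Summits.CriticalPhenomena.PercolationContinuityZ3.Theorems.PercNearOneGluingNoHeavyLowerTailSunflowerPrincipalBottom
import Literature.Probability.LatticeModels.SahiE3Reflection
import HarnessLib

/-!
# `NoHeavyLowerTail` (crux stmt-CriticalPhenomena-4575), abstract sunflower cubic: the Δ-SYSTEM-BOTTOM stratum (dual of
# `…SunflowerDeltaCore` under the reflection `ω ↦ ωᶜ`, `p ↦ 1 − p`) — Lemma B unconditional when the maximal elements of the bottom cell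
# form a co-Δ-system, and GW on a Δ-system cap

Support file (seat `prim-ineq-prove-1` gen 34; `--supports stmt-CriticalPhenomena-4575`).  No `sorry`, no named facts.  Memo:
run/shared/lean/prim/prim-ineq-prove-1/FINDING-PRINCIPALCORE-prove1-g34.md §5.

* `DeltaCore.prod_real_le_real_codcore_pow` — for DOWN-sets `D i` of a finite cube whose pairwise intersections lie in the "co-core"
  `B = {ω | ∃ k, ω ∩ Am k = ∅}` of sets `Am k` with `Am k ∩ Am l ⊆ h ⊆ Am m` (`k ≠ l`; i.e. the maximal elements `(Am k)ᶜ` of `B` have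
  pairwise UNION `hᶜ`): `∏_i μ(D i) ≤ μ(B)^(|κ|−1)` for every `p`.
* `gwLadder_of_deltaCap`, `gw_of_deltaCap` — prim-ineq-gen-2's GW / GW_k for up-sets whose total intersection is a Δ-system core
  `{ω | ∃ k, Am k ⊆ ω}`.
* For a three-petal SUNFLOWER of up-sets `E_i` whose bottom cell `(E₁ ∪ E₂ ∪ E₃)ᶜ` is such a `B`: `lemmaB_of_deltaBottom`
  (`Π μ((E_j ∪ E_k)ᶜ) ≤ b²`), Lemma B in cells `e3_le_bottom_mul_AG_of_deltaBottom`, and (C1-law) `e3_le_max_mul_AG_of_deltaBottom` —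
  unconditionally.
-/

noncomputable section

namespace Summit.CriticalPhenomena.PercolationContinuityZ3.Theorems.SunflowerPartition

namespace DeltaCore

open MeasureTheory Finset
open Literature.Probability.LatticeModels Literature.Probability.Percolation

variable {ι : Type*} [DecidableEq ι] [Fintype ι] {β : Type*} [Fintype β] [DecidableEq β] {κ : Type*} [Fintype κ]

/-- The co-core of the sets `Am k`: configurations avoiding some `Am k`. [this work] -/
def codcore (Am : β → Finset ι) : Set (Set ι) := {ω | ∃ k, ∀ e ∈ Am k, e ∉ ω}

omit [DecidableEq ι] [Fintype ι] [Fintype β] [DecidableEq β] in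
/-- The reflection of the co-core is the core generated by the `Am k`. [this work] -/
theorem preimage_compl_codcore (Am : β → Finset ι) : compl ⁻¹' codcore Am = {ω | ∃ k, (Am k : Set ι) ⊆ ω} := by
  ext ω
  simp only [codcore, Set.preimage_setOf_eq, Set.mem_setOf_eq, Set.mem_compl_iff, not_not]
  rfl

/-- **Δ-system co-core theorem** (reflection of `prod_real_le_real_deltaCore_pow`): for sets `Am k` with `Am k ∩ Am l ⊆ h ⊆ Am m`
(`k ≠ l`) and down-sets `D i` with pairwise intersections in `codcore Am`, `∏_i μ(D i) ≤ μ(codcore Am)^(|κ|−1)`. [this work] -/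
theorem prod_real_le_real_codcore_pow (p : ι → unitInterval) (Am : β → Finset ι) (h : Finset ι) (hsub : ∀ k, h ⊆ Am k)
    (hΔ : ∀ k l, k ≠ l → Am k ∩ Am l ⊆ h) {D : κ → Set (Set ι)}
    (hD : ∀ i, IsLowerSet (D i)) (hcap : ∀ i j, i ≠ j → D i ∩ D j ⊆ codcore Am) :
    ∏ i, (prodBernoulli p).real (D i) ≤ ((prodBernoulli p).real (codcore Am)) ^ (Fintype.card κ - 1) := by
  classical
  let q : ι → unitInterval := fun i => unitInterval.symm (p i)
  have hV : ∀ i, IsUpperSet (compl ⁻¹' D i) := fun i => isUpperSet_preimage_compl (hD i)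
  have hcap' : ∀ i j, i ≠ j → (compl ⁻¹' D i) ∩ (compl ⁻¹' D j) ⊆ {ω | ∃ k, (Am k : Set ι) ⊆ ω} := by
    intro i j hij ω hω
    rw [← preimage_compl_codcore]
    exact hcap i j hij hω
  have key := prod_real_le_real_deltaCore_pow q Am h hsub hΔ hV hcap'
  have hre : ∀ i, (prodBernoulli q).real (compl ⁻¹' D i) = (prodBernoulli p).real (D i) := fun i =>
    prodBernoulli_real_preimage_compl p MeasurableSet.of_discrete
  have hco : (prodBernoulli q).real {ω | ∃ k, (Am k : Set ι) ⊆ ω} = (prodBernoulli p).real (codcore Am) := by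
    rw [← preimage_compl_codcore]; exact prodBernoulli_real_preimage_compl p MeasurableSet.of_discrete
  simp only [hre, hco] at key
  exact key

/-- **Lemma B shape for a Δ-system bottom.**  For ANY three up-sets `E_i` of a finite cube whose union has complement `codcore Am`
(`Am k ∩ Am l ⊆ h ⊆ Am m` for `k ≠ l`), the down-sets `D_i = (E_j ∪ E_k)ᶜ` satisfy `μ(D₁) μ(D₂) μ(D₃) ≤ μ((E₁ ∪ E₂ ∪ E₃)ᶜ)²`. [this work] -/
theorem lemmaB_of_deltaBottom (p : ι → unitInterval) {E₁ E₂ E₃ : Set (Set ι)} (h₁ : IsUpperSet E₁) (h₂ : IsUpperSet E₂)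
    (h₃ : IsUpperSet E₃) (Am : β → Finset ι) (h : Finset ι) (hsub : ∀ k, h ⊆ Am k) (hΔ : ∀ k l, k ≠ l → Am k ∩ Am l ⊆ h)
    (hB : (E₁ ∪ E₂ ∪ E₃)ᶜ = codcore Am) :
    (prodBernoulli p).real (E₂ ∪ E₃)ᶜ * (prodBernoulli p).real (E₁ ∪ E₃)ᶜ * (prodBernoulli p).real (E₁ ∪ E₂)ᶜ ≤
      ((prodBernoulli p).real (E₁ ∪ E₂ ∪ E₃)ᶜ) ^ 2 := by
  let D : Fin 3 → Set (Set ι) := ![(E₂ ∪ E₃)ᶜ, (E₁ ∪ E₃)ᶜ, (E₁ ∪ E₂)ᶜ]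
  have hD : ∀ i, IsLowerSet (D i) := by
    intro i; fin_cases i
    · exact (h₂.union h₃).compl
    · exact (h₁.union h₃).compl
    · exact (h₁.union h₂).compl
  have hsub3 : ∀ i j, i ≠ j → D i ∩ D j ⊆ (E₁ ∪ E₂ ∪ E₃)ᶜ := by
    intro i j hij ω hω
    simp only [Set.mem_compl_iff, Set.mem_union, not_or]
    fin_cases i <;> fin_cases j
    all_goals first
      | exact (hij rfl).elim
      | (change ω ∈ (E₂ ∪ E₃)ᶜ ∩ (E₁ ∪ E₃)ᶜ at hω
         simp only [Set.mem_inter_iff, Set.mem_compl_iff, Set.mem_union, not_or] at hω; tauto)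
      | (change ω ∈ (E₂ ∪ E₃)ᶜ ∩ (E₁ ∪ E₂)ᶜ at hω
         simp only [Set.mem_inter_iff, Set.mem_compl_iff, Set.mem_union, not_or] at hω; tauto)
      | (change ω ∈ (E₁ ∪ E₃)ᶜ ∩ (E₂ ∪ E₃)ᶜ at hω
         simp only [Set.mem_inter_iff, Set.mem_compl_iff, Set.mem_union, not_or] at hω; tauto)
      | (change ω ∈ (E₁ ∪ E₃)ᶜ ∩ (E₁ ∪ E₂)ᶜ at hω
         simp only [Set.mem_inter_iff, Set.mem_compl_iff, Set.mem_union, not_or] at hω; tauto)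
      | (change ω ∈ (E₁ ∪ E₂)ᶜ ∩ (E₂ ∪ E₃)ᶜ at hω
         simp only [Set.mem_inter_iff, Set.mem_compl_iff, Set.mem_union, not_or] at hω; tauto)
      | (change ω ∈ (E₁ ∪ E₂)ᶜ ∩ (E₁ ∪ E₃)ᶜ at hω
         simp only [Set.mem_inter_iff, Set.mem_compl_iff, Set.mem_union, not_or] at hω; tauto)
  have hcap : ∀ i j, i ≠ j → D i ∩ D j ⊆ codcore Am := fun i j hij => (hsub3 i j hij).trans hB.le
  have key := prod_real_le_real_codcore_pow p Am h hsub hΔ hD hcap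
  rw [Fin.prod_univ_three, ← hB] at key
  simp only [D, Matrix.cons_val_zero, Matrix.cons_val_one, Matrix.cons_val, Fintype.card_fin] at key
  calc (prodBernoulli p).real (E₂ ∪ E₃)ᶜ * (prodBernoulli p).real (E₁ ∪ E₃)ᶜ * (prodBernoulli p).real (E₁ ∪ E₂)ᶜ
      ≤ ((prodBernoulli p).real (E₁ ∪ E₂ ∪ E₃)ᶜ) ^ (3 - 1) := key
    _ = ((prodBernoulli p).real (E₁ ∪ E₂ ∪ E₃)ᶜ) ^ 2 := by norm_num

/-- **Lemma B in cells** (`c₁c₂c₃ ≤ b(ab − e₂)`) for a sunflower whose bottom cell is a Δ-system co-core, unconditionally. [this work] -/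
theorem e3_le_bottom_mul_AG_of_deltaBottom (p : ι → unitInterval) {E₁ E₂ E₃ A : Set (Set ι)} (h₁ : IsUpperSet E₁)
    (h₂ : IsUpperSet E₂) (h₃ : IsUpperSet E₃) (h12 : E₁ ∩ E₂ = A) (h13 : E₁ ∩ E₃ = A) (h23 : E₂ ∩ E₃ = A) (Am : β → Finset ι)
    (h : Finset ι) (hsub : ∀ k, h ⊆ Am k) (hΔ : ∀ k l, k ≠ l → Am k ∩ Am l ⊆ h) (hB : (E₁ ∪ E₂ ∪ E₃)ᶜ = codcore Am) :
    (prodBernoulli p).real (E₁ \ A) * (prodBernoulli p).real (E₂ \ A) * (prodBernoulli p).real (E₃ \ A) ≤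
      (prodBernoulli p).real (E₁ ∪ E₂ ∪ E₃)ᶜ * ((prodBernoulli p).real A * (prodBernoulli p).real (E₁ ∪ E₂ ∪ E₃)ᶜ -
        ((prodBernoulli p).real (E₁ \ A) * (prodBernoulli p).real (E₂ \ A) +
          (prodBernoulli p).real (E₁ \ A) * (prodBernoulli p).real (E₃ \ A) +
          (prodBernoulli p).real (E₂ \ A) * (prodBernoulli p).real (E₃ \ A))) := by
  have key := lemmaB_of_deltaBottom p h₁ h₂ h₃ Am h hsub hΔ hB
  obtain ⟨d₁, d₂, d₃⟩ := PrincipalCore.cells_eq' p h12 h13 h23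
  obtain ⟨-, -, -, eB⟩ := PrincipalCore.cells_eq p h12 h13 h23
  rw [d₁, d₂, d₃] at key
  have ha : (prodBernoulli p).real A = 1 - (prodBernoulli p).real (E₁ ∪ E₂ ∪ E₃)ᶜ - (prodBernoulli p).real (E₁ \ A)
      - (prodBernoulli p).real (E₂ \ A) - (prodBernoulli p).real (E₃ \ A) := by linarith
  rw [ha]
  nlinarith [key]

/-- **(C1-law) on the Δ-system-bottom stratum**, unconditionally. [this work] -/
theorem e3_le_max_mul_AG_of_deltaBottom (p : ι → unitInterval) {E₁ E₂ E₃ A : Set (Set ι)} (h₁ : IsUpperSet E₁)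
    (h₂ : IsUpperSet E₂) (h₃ : IsUpperSet E₃) (h12 : E₁ ∩ E₂ = A) (h13 : E₁ ∩ E₃ = A) (h23 : E₂ ∩ E₃ = A) (Am : β → Finset ι)
    (h : Finset ι) (hsub : ∀ k, h ⊆ Am k) (hΔ : ∀ k l, k ≠ l → Am k ∩ Am l ⊆ h) (hB : (E₁ ∪ E₂ ∪ E₃)ᶜ = codcore Am) :
    (prodBernoulli p).real (E₁ \ A) * (prodBernoulli p).real (E₂ \ A) * (prodBernoulli p).real (E₃ \ A) ≤
      max ((prodBernoulli p).real A) ((prodBernoulli p).real (E₁ ∪ E₂ ∪ E₃)ᶜ) *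
        ((prodBernoulli p).real A * (prodBernoulli p).real (E₁ ∪ E₂ ∪ E₃)ᶜ -
          ((prodBernoulli p).real (E₁ \ A) * (prodBernoulli p).real (E₂ \ A) +
            (prodBernoulli p).real (E₁ \ A) * (prodBernoulli p).real (E₃ \ A) +
            (prodBernoulli p).real (E₂ \ A) * (prodBernoulli p).real (E₃ \ A))) := by
  have hLB := e3_le_bottom_mul_AG_of_deltaBottom p h₁ h₂ h₃ h12 h13 h23 Am h hsub hΔ hB
  have hAG := prodBernoulli_strongHarris_sunflower_three p h₁ h₂ h₃ h12 h13 h23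
  have hmax : (prodBernoulli p).real (E₁ ∪ E₂ ∪ E₃)ᶜ ≤
      max ((prodBernoulli p).real A) ((prodBernoulli p).real (E₁ ∪ E₂ ∪ E₃)ᶜ) := le_max_right _ _
  nlinarith [hmax, hAG, hLB]

/-! ## GW on a Δ-system cap (prim-ineq-gen-2's formulation) -/

/-- **GW `k`-set ladder on a Δ-system cap**: for up-sets `W i` whose total intersection is the core generated by sets `Am k` with
`Am k ∩ Am l ⊆ h ⊆ Am m` (`k ≠ l`), `∏_i μ(⋂_{j ≠ i} W j) ≤ μ(⋂_i W i)^(|κ|−1)`, with no density hypothesis. [this work] -/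
theorem gwLadder_of_deltaCap (p : ι → unitInterval) (Am : β → Finset ι) (h : Finset ι) (hsub : ∀ k, h ⊆ Am k)
    (hΔ : ∀ k l, k ≠ l → Am k ∩ Am l ⊆ h) {W : κ → Set (Set ι)}
    (hW : ∀ i, IsUpperSet (W i)) (hcap : (⋂ i, W i) = {ω | ∃ k, (Am k : Set ι) ⊆ ω}) :
    ∏ i, (prodBernoulli p).real (⋂ j ∈ ({i}ᶜ : Set κ), W j) ≤ ((prodBernoulli p).real (⋂ i, W i)) ^ (Fintype.card κ - 1) := by
  classical
  have hV : ∀ i, IsUpperSet (⋂ j ∈ ({i}ᶜ : Set κ), W j) := fun i => isUpperSet_iInter₂ fun j _ => hW j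
  have hcap' : ∀ i l, i ≠ l → (⋂ j ∈ ({i}ᶜ : Set κ), W j) ∩ (⋂ j ∈ ({l}ᶜ : Set κ), W j) ⊆ {ω | ∃ k, (Am k : Set ι) ⊆ ω} := by
    intro i l hil ω hω
    rw [← hcap, Set.mem_iInter]
    intro j
    obtain ⟨h1, h2⟩ := hω
    rw [Set.mem_iInter₂] at h1 h2
    by_cases hji : j = i
    · subst hji
      exact h2 j (by simpa using hil)
    · exact h1 j (by simpa using hji)
  rw [hcap]
  exact prod_real_le_real_deltaCore_pow p Am h hsub hΔ hV hcap'

/-- **GW on a Δ-system cap, three sets**: `μ(W₁∩W₂) μ(W₁∩W₃) μ(W₂∩W₃) ≤ μ(W₁∩W₂∩W₃)²` whenever `W₁ ∩ W₂ ∩ W₃` is the core generated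
by sets `Am k` with `Am k ∩ Am l ⊆ h ⊆ Am m` (`k ≠ l`). [this work] -/
theorem gw_of_deltaCap (p : ι → unitInterval) (Am : β → Finset ι) (h : Finset ι) (hsub : ∀ k, h ⊆ Am k)
    (hΔ : ∀ k l, k ≠ l → Am k ∩ Am l ⊆ h) {W₁ W₂ W₃ : Set (Set ι)}
    (h₁ : IsUpperSet W₁) (h₂ : IsUpperSet W₂) (h₃ : IsUpperSet W₃) (hcap : W₁ ∩ W₂ ∩ W₃ = {ω | ∃ k, (Am k : Set ι) ⊆ ω}) :
    (prodBernoulli p).real (W₁ ∩ W₂) * (prodBernoulli p).real (W₁ ∩ W₃) * (prodBernoulli p).real (W₂ ∩ W₃) ≤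
      ((prodBernoulli p).real (W₁ ∩ W₂ ∩ W₃)) ^ 2 := by
  let V : Fin 3 → Set (Set ι) := ![W₂ ∩ W₃, W₁ ∩ W₃, W₁ ∩ W₂]
  have hV : ∀ i, IsUpperSet (V i) := by
    intro i; fin_cases i
    · exact h₂.inter h₃
    · exact h₁.inter h₃
    · exact h₁.inter h₂
  have hcap' : ∀ i j, i ≠ j → V i ∩ V j ⊆ {ω | ∃ k, (Am k : Set ι) ⊆ ω} := by
    intro i j hij ω hω
    rw [← hcap]
    fin_cases i <;> fin_cases j
    all_goals first
      | exact (hij rfl).elim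
      | (simp only [V] at hω
         obtain ⟨⟨ha, hb⟩, ⟨hc, hd⟩⟩ := hω
         refine ⟨⟨?_, ?_⟩, ?_⟩ <;> assumption)
  have key := prod_real_le_real_deltaCore_pow p Am h hsub hΔ hV hcap'
  rw [Fin.prod_univ_three] at key
  simp only [V, Matrix.cons_val_zero, Matrix.cons_val_one, Matrix.cons_val, Fintype.card_fin] at key
  rw [hcap]
  calc (prodBernoulli p).real (W₁ ∩ W₂) * (prodBernoulli p).real (W₁ ∩ W₃) * (prodBernoulli p).real (W₂ ∩ W₃)
      = (prodBernoulli p).real (W₂ ∩ W₃) * (prodBernoulli p).real (W₁ ∩ W₃) * (prodBernoulli p).real (W₁ ∩ W₂) := by ring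
    _ ≤ ((prodBernoulli p).real {ω | ∃ k, (Am k : Set ι) ⊆ ω}) ^ (3 - 1) := key
    _ = ((prodBernoulli p).real {ω | ∃ k, (Am k : Set ι) ⊆ ω}) ^ 2 := by norm_num

end DeltaCore

end Summit.CriticalPhenomena.PercolationContinuityZ3.Theorems.SunflowerPartition
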